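/-
Copyright (c) 2026. All rights reserved.
Released under Apache 2.0 license as described in the file LICENSE.
-/
import Literature.Geometry.Kaehler.ComplexTorusQuaternionOrderThreeSymmetry
import HarnessLib

/-!
# Lang's order `ℤ⟨1, i, j, ij⟩ ⊂ (−1,3)_ℚ` inside the maximal order `O₆ = ℤ[1, I, J, (1 + I + J + K)/2]` of Bayer–Travesa:
# index `2`, `e = (1 + i + j − ij)/2` with `e² = e + 1`, `β = 2e²`, `O₆ = 𝔬 ⊔ 𝔬e² ⊔ 𝔬e⁴` — so `Γ₆ = Γ ⊔ Γσ ⊔ Γσ²` and Lang's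
# curve is a cyclic triple cover of the Shimura curve `X₆` — and the elliptic / special CM points of `X₆` (Bayer–Travesa 2007,
# §1 Thm. 1.1, Table 1) recovered from Lang's curve: `τ_h ≡ τ_k ≢ i`, `τ₆ ≡ τ₆″ ≢ i√(2 − √3)` modulo `Γ₆`

[tag: complex_torus] [tag: abelian_surface] [tag: quaternion_multiplication] [tag: complex_multiplication]
[tag: shimura_curve] [tag: special_cycles] [tag: quaternion_order] [tag: maximal_order] [tag: elliptic_points]

Lane `lit-hodgefound`, seat p12, row g30-#4 — THEOREMS ONLY (no definition, no named fact, no instance); the sequel of g30-#3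
(`…OrderThreeSymmetry`: `β = 3 + i + j − ij` normalises `𝔬`, `σ = ρ(β)` has order `3` on `Γ∖𝔥` and permutes the CM points).
Setting: Lang's family over `(−1,3)_ℚ`, `𝔬 = ℤ⟨1, i, j, ij⟩` (`order (-1) 3`), `Γ = ρ(𝔬¹)`. Bayer–Travesa work in
`H₆ = (3, −1)_ℚ` with basis `1, I, J, K = IJ` and the embedding `Φ(x + yI + zJ + tK) = (x + y√3, z + t√3; −(z − t√3), x − y√3)`;
comparing with the tree's `ρ(x₀ + x₁i + x₂j + x₃ij) = (x₀ + √3x₂, −x₁ + √3x₃; x₁ + √3x₃, x₀ − √3x₂)` gives the dictionary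
`I = j`, `J = −i`, `K = IJ = ij`, `Φ = ρ`, so their maximal order `O₆ = ℤ[1, I, J, (1 + I + J + K)/2]` is `𝔬 + ℤe` with
`e := (1 + i + j − ij)/2` (`(1 + I + J + K)/2 − e = −i + ij ∈ 𝔬`), and their `Γ₆ = Φ((O₆)*₁) = ρ(O₆¹)`. The set `O₆` is written
here WITHOUT a new definition as the predicate `x ∈ 𝔬 ∨ x − e ∈ 𝔬`.

## The print, VERBATIM

* P. Bayer, A. Travesa, *Uniformizing functions for certain Shimura curves, in the case D = 6*, Acta Arith. 126 (2007)
  [BayerTravesa2007] §1 p. 316: «Let `H₆` be the rational quaternion algebra with basis `{1, I, J, K}` and defined by `I² = 3`,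
  `J² = −1`, `IJ = −JI = K`. Its discriminant … is equal to `6` … we fix the embedding `Φ : H₆ → M(2, ℝ)` … All maximal
  orders in `H₆` are conjugate, and we fix the representative in this conjugacy class to be `O₆ := ℤ[1, I, J, (1 + I + J + K)/2]`.
  Let `(O₆)*₁ = {γ ∈ O₆ : n(γ) = 1}` … identified with its image `Γ₆ ⊆ SL(2, ℝ)` under `Φ`. This group admits the following
  description, given in [1]: `Γ₆ = {γ = ½(α, β; −β′, α′) : α, β ∈ ℤ[√3], det γ = 1, α ≡ β ≡ α√3 (mod 2)}`»;
  p. 317 Thm. 1.1: «Consider the hyperbolic hexagon `[P₁, …, P₆]` with vertices `Pᵢ` given in Table 1 … The vertices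
  `P₁ ≡ P₃ ≡ P₅ (mod Γ₆)` and `P₆` are elliptic of order `2`; the remaining vertices `P₂, P₄` are elliptic of order `3`. The
  points `P₀, P₇ ≡ P₈ (mod Γ₆)` in Table 1 are a full set of representatives of the special complex multiplication (SCM)
  points of the genus zero curve `X₆`»; p. 318 Table 1: `P₃ = (2 − √3)i`, `P₅ = (√3 + i)/2`, `P₆ = i`, `P₇ = (1 + √2i)/√3`,
  `P₀ = (√6 − √2)i/2`.
* A. P. Ogg (1983) [Ogg1983RealPoints] §2 p. 283 («`𝒪 = μ𝒪μ⁻¹` … `𝒪^× = μ𝒪^×μ⁻¹`»); Kudla–Rapoport–Yang (2006)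
  [KudlaRapoportYang2006] §3.2 Prop. 3.2.1, §3.4 (3.4.9), (3.4.13); Lang (1982) [Lang1982AbelianFunctions] Ch. IX §4–§5.

In the tree's coordinates: `P₃ = τ_k`, `P₅ = τ_h`, `P₆ = i` (the three `Γ`-inequivalent elliptic points with `A ≅ C_i²` of
g29-#3), `P₇ = τ₆ = (√3 + i√6)/3`, `P₀ = i√(2 − √3)` (the `Z(6)`-points of g28-#6/g29-#1).

## What is proved (`e = (1/2, 1/2, 1/2, −1/2)`, `O₆ := {x ∣ x ∈ 𝔬 ∨ x − e ∈ 𝔬}`)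

* §1 `2e = 1 + i + j − ij ∈ 𝔬`, **`e ∉ 𝔬`**, **`e² = e + 1`** (`= (3 + i + j − ij)/2`), `(e²)‾ = (3 − i − j + ij)/2`,
  **`e²(e²)‾ = (e²)‾e² = 1`**, **`eē = −1`**, **`e³ = 2 + i + j − ij ∈ 𝔬` with `nr = −1`**, and **`β = 3 + i + j − ij = 2e²`**
  (g30-#3's `σ = ρ(β)` is the Möbius transformation of the norm-one unit `e²` of `O₆`).
* §2 **`O₆` is an additive group containing `𝔬` with `2·O₆ ⊆ 𝔬` (index `2`, `e ∉ 𝔬`) and CLOSED UNDER MULTIPLICATION**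
  (`maxOrder_add/neg/mul`, via `n·e, e·n ∈ O₆` for `n ∈ 𝔬`: the numerators of `2ne` are all `≡ n₀ + n₁ + n₂ + n₃ (mod 2)`);
  **`Ad(e)`: `ex = (x₀, −2x₁ + 3x₂, −x₃, x₁ − 2x₂)e`, inverse `e(y₀, −2y₁ − 3y₃, −y₁ − 2y₃, −y₂) = ye`, so `e𝔬 = 𝔬e`**:
  `e` normalises Lang's order (`exists_e_mul_eq_and`).
* §3 **TRICHOTOMY: for `u = e + n`, `n ∈ 𝔬`: `u(e²)‾ ∈ 𝔬` if `Σnᵢ` is odd, `u(e²)‾(e²)‾ ∈ 𝔬` if `Σnᵢ` is even** (explicit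
  coordinates), hence **`O₆ = 𝔬 ⊔ 𝔬·e² ⊔ 𝔬·e²e²`** (`exists_order_mul_e_pow`), norms preserved along the cosets; **`Γ₆ = Γ ∪ Γσ ∪
  Γσ²` on `𝔥`: every `u ∈ O₆` with `uū = 1` acts as `ρ(v)`, `ρ(v)∘σ` or `ρ(v)∘σ∘σ` for some `v ∈ 𝔬`, `vv̄ = 1`**
  (`exists_order_unit_moebius_eq`); and **`ρ(7 + 3i + 3j − 3ij) = ρ(β²)/2 ∉ ℝ^×ρ(𝔬^×)`** (`rho_beta_sq_ne_smul_rho_unit`), which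
  with g30-#3's `ρ(β) ∉ ℝ^×ρ(𝔬^×)` makes the three cosets distinct: **`[Γ₆ : Γ] = 3`**.
* §4 (Bayer–Travesa Thm. 1.1 / Table 1 from Lang's curve) the general **`exē = y`, `eē = 1`, `ρ(x)z₁ = z₁`, `ρ(y)z₂ = z₂ ⟹
  ρ(e)z₁ = z₂`** (`moebius_eq_of_conj_norm_one`); **`P₃ ≡ P₅`: `u = −ie² = (1 − 3i − j − ij)/2 ∈ O₆`, `uū = 1`, `ρ(u)τ_h = τ_k`**;
  **`P₇`: `ρ(u)τ₆ = τ₆″`**; **`P₆ ≢ P₅`: NO `u ∈ O₆` with `uū = 1` maps `i` to `τ_h`** (via `Γ₆ = Γ ⊔ Γσ ⊔ Γσ²` and `i`,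
  `σi ≅_ρ w₃τ_h`, `σ²i ≅_ρ w₃τ_k` all `Γ`-inequivalent to `τ_h`); **`P₇ ≢ P₀`: no such `u` maps `τ₆` to `i√(2 − √3)`**.

## Honest scope

`O₆` is handled as the explicit set `𝔬 ∪ (e + 𝔬)`; that it is a MAXIMAL order (reduced discriminant `6`) is Bayer–Travesa's
statement and is not re-proved here (no discriminant is computed); no fundamental domain, no genus, no claim that `i`, `τ_h`
are the ONLY elliptic points of order `2` of `X₆` or that `P₀`, `P₇` exhaust its SCM points (only the (in)equivalences printed
in Thm. 1.1 for the points the tree already has); the order-`3` elliptic points `P₂`, `P₄` are not treated. 0 definitions,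
0 named facts, 0 instances — net debt `0`.

## References
* [BayerTravesa2007] P. Bayer, A. Travesa, *Uniformizing functions for certain Shimura curves, in the case D = 6*, Acta
  Arith. 126 (2007), no. 4, 315–339, §1 (p. 316), Thm. 1.1 (p. 317), Table 1 (p. 318).
* [Ogg1983RealPoints] A. P. Ogg, *Real points on Shimura curves* (1983), §2 p. 283.
* [KudlaRapoportYang2006] S. Kudla, M. Rapoport, T. Yang, *Modular Forms and Special Cycles on Shimura Curves* (2006),
  §3.2 Prop. 3.2.1, §3.4 (3.4.9), (3.4.13).
* [Lang1982AbelianFunctions] S. Lang, *Introduction to Algebraic and Abelian Functions*, 2nd ed. (1982), Ch. IX §4–§5.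
-/

noncomputable section

set_option maxSynthPendingDepth 3

open Complex Module Matrix Quaternion Function
open scoped ComplexConjugate

namespace Literature.Geometry.Kaehler.ComplexTorus.QuaternionType

/-! ## §1 The element `e = (1 + i + j − ij)/2`: `e² = e + 1`, `e³ = 2 + i + j − ij ∈ 𝔬^×` (norm `−1`), `β = 2e²` -/

section GoldenUnit

/-- `2e = 1 + i + j − ij ∈ 𝔬`. [cite: BayerTravesa2007, §1 («`O₆ := ℤ[1, I, J, (1 + I + J + K)/2]`»)] -/
theorem two_smul_e :
    (2 : ℚ) • (⟨1/2, 1/2, 1/2, -1/2⟩ : ℍ[ℚ,((-1 : ℤ) : ℚ),((3 : ℤ) : ℚ)]) = ⟨1, 1, 1, -1⟩ := by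
  rw [QuaternionAlgebra.smul_mk]; ext <;> norm_num

/-- `2e ∈ 𝔬`. [cite: BayerTravesa2007, §1] -/
theorem two_smul_e_mem_order :
    (2 : ℚ) • (⟨1/2, 1/2, 1/2, -1/2⟩ : ℍ[ℚ,((-1 : ℤ) : ℚ),((3 : ℤ) : ℚ)]) ∈ order (-1) 3 := by
  rw [two_smul_e]; exact ⟨![1, 1, 1, -1], by ext <;> simp [ofCoords]⟩

/-- **`e ∉ 𝔬 = ℤ⟨1, i, j, ij⟩`**: Lang's order is strictly smaller than `O₆`. [cite: BayerTravesa2007, §1] [cite: Lang1982AbelianFunctions, Ch. IX §4] -/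
theorem e_not_mem_order : (⟨1/2, 1/2, 1/2, -1/2⟩ : ℍ[ℚ,((-1 : ℤ) : ℚ),((3 : ℤ) : ℚ)]) ∉ order (-1) 3 := by
  rintro ⟨m, hm⟩
  have h := congrArg QuaternionAlgebra.re hm
  simp only [ofCoords_re] at h
  have h2 : (2 : ℤ) * m 0 = 1 := by exact_mod_cast (show (2 : ℚ) * (m 0 : ℚ) = 1 by rw [h]; norm_num)
  omega

/-- **`e² = e + 1`** (`tr e = 1`, `nr e = −1`). [cite: BayerTravesa2007, §1] -/
theorem e_mul_e_eq_e_add_one :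
    (⟨1/2, 1/2, 1/2, -1/2⟩ : ℍ[ℚ,((-1 : ℤ) : ℚ),((3 : ℤ) : ℚ)]) * ⟨1/2, 1/2, 1/2, -1/2⟩ =
      ⟨1/2, 1/2, 1/2, -1/2⟩ + 1 := by
  rw [QuaternionAlgebra.mk_mul_mk]; ext <;> norm_num

/-- `e² = (3 + i + j − ij)/2` in coordinates. [cite: BayerTravesa2007, §1] -/
theorem e_sq_eq :
    (⟨1/2, 1/2, 1/2, -1/2⟩ : ℍ[ℚ,((-1 : ℤ) : ℚ),((3 : ℤ) : ℚ)]) * ⟨1/2, 1/2, 1/2, -1/2⟩ = ⟨3/2, 1/2, 1/2, -1/2⟩ := by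
  rw [QuaternionAlgebra.mk_mul_mk]; ext <;> norm_num

/-- `ē² := (e²)‾ = (3 − i − j + ij)/2`. [cite: BayerTravesa2007, §1] -/
theorem star_e_sq :
    star ((⟨1/2, 1/2, 1/2, -1/2⟩ : ℍ[ℚ,((-1 : ℤ) : ℚ),((3 : ℤ) : ℚ)]) * ⟨1/2, 1/2, 1/2, -1/2⟩) =
      ⟨3/2, -1/2, -1/2, 1/2⟩ := by
  rw [e_sq_eq, QuaternionAlgebra.star_mk]; ext <;> norm_num

/-- **`nr(e²) = 1`: `e²·(e²)‾ = 1` and `(e²)‾·e² = 1`** — `e²` is a unit of reduced norm one of `O₆`. [cite: BayerTravesa2007, §1 («`(O₆)*₁ = {γ ∈ O₆ : n(γ) = 1}`»)] -/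
theorem e_sq_mul_star_and :
    (⟨1/2, 1/2, 1/2, -1/2⟩ : ℍ[ℚ,((-1 : ℤ) : ℚ),((3 : ℤ) : ℚ)]) * ⟨1/2, 1/2, 1/2, -1/2⟩ *
        star ((⟨1/2, 1/2, 1/2, -1/2⟩ : ℍ[ℚ,((-1 : ℤ) : ℚ),((3 : ℤ) : ℚ)]) * ⟨1/2, 1/2, 1/2, -1/2⟩) = 1 ∧
    star ((⟨1/2, 1/2, 1/2, -1/2⟩ : ℍ[ℚ,((-1 : ℤ) : ℚ),((3 : ℤ) : ℚ)]) * ⟨1/2, 1/2, 1/2, -1/2⟩) *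
        ((⟨1/2, 1/2, 1/2, -1/2⟩ : ℍ[ℚ,((-1 : ℤ) : ℚ),((3 : ℤ) : ℚ)]) * ⟨1/2, 1/2, 1/2, -1/2⟩) = 1 := by
  rw [star_e_sq, e_sq_eq, QuaternionAlgebra.mk_mul_mk, QuaternionAlgebra.mk_mul_mk]
  constructor <;> ext <;> norm_num

/-- **`nr e = −1`**: `e` is a unit of `O₆` of norm `−1`. [cite: BayerTravesa2007, §1] -/
theorem e_mul_star :
    (⟨1/2, 1/2, 1/2, -1/2⟩ : ℍ[ℚ,((-1 : ℤ) : ℚ),((3 : ℤ) : ℚ)]) * star ⟨1/2, 1/2, 1/2, -1/2⟩ = -1 := by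
  rw [QuaternionAlgebra.star_mk, QuaternionAlgebra.mk_mul_mk]; ext <;> norm_num

/-- **`e³ = 2e + 1 = 2 + i + j − ij ∈ 𝔬`**, a unit of norm `−1` of LANG's order. [cite: BayerTravesa2007, §1] [cite: Lang1982AbelianFunctions, Ch. IX §5 («units of norm `−1`»)] -/
theorem e_cube :
    (⟨1/2, 1/2, 1/2, -1/2⟩ : ℍ[ℚ,((-1 : ℤ) : ℚ),((3 : ℤ) : ℚ)]) * ⟨1/2, 1/2, 1/2, -1/2⟩ * ⟨1/2, 1/2, 1/2, -1/2⟩ =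
      ⟨2, 1, 1, -1⟩ ∧
    (⟨2, 1, 1, -1⟩ : ℍ[ℚ,((-1 : ℤ) : ℚ),((3 : ℤ) : ℚ)]) ∈ order (-1) 3 ∧
    (⟨2, 1, 1, -1⟩ : ℍ[ℚ,((-1 : ℤ) : ℚ),((3 : ℤ) : ℚ)]) * star ⟨2, 1, 1, -1⟩ = -1 := by
  refine ⟨?_, ⟨![2, 1, 1, -1], by ext <;> simp [ofCoords]⟩, ?_⟩
  · rw [QuaternionAlgebra.mk_mul_mk, QuaternionAlgebra.mk_mul_mk]; ext <;> norm_num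
  · rw [QuaternionAlgebra.star_mk, QuaternionAlgebra.mk_mul_mk]; ext <;> norm_num

/-- **`β = 3 + i + j − ij = 2e²`**: the order-three symmetry `σ = ρ(β)` of g30-#3 is the Möbius transformation of the
norm-one unit `e²` of the maximal order. [cite: BayerTravesa2007, §1] [cite: Ogg1983RealPoints, §2 p. 283] -/
theorem beta_eq_two_smul_e_sq :
    (⟨3, 1, 1, -1⟩ : ℍ[ℚ,((-1 : ℤ) : ℚ),((3 : ℤ) : ℚ)]) =
      (2 : ℚ) • ((⟨1/2, 1/2, 1/2, -1/2⟩ : ℍ[ℚ,((-1 : ℤ) : ℚ),((3 : ℤ) : ℚ)]) * ⟨1/2, 1/2, 1/2, -1/2⟩) := by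
  rw [e_sq_eq, QuaternionAlgebra.smul_mk]; ext <;> norm_num

end GoldenUnit

/-! ## §2 `O₆ = 𝔬 ∪ (e + 𝔬)` is a ring in which `𝔬` has index `2`; `e` normalises `𝔬` -/

section MaximalOrder

/-- `O₆` is closed under addition. [cite: BayerTravesa2007, §1] -/
theorem maxOrder_add {x y : ℍ[ℚ,((-1 : ℤ) : ℚ),((3 : ℤ) : ℚ)]}
    (hx : x ∈ order (-1) 3 ∨ x - ⟨1/2, 1/2, 1/2, -1/2⟩ ∈ order (-1) 3)
    (hy : y ∈ order (-1) 3 ∨ y - ⟨1/2, 1/2, 1/2, -1/2⟩ ∈ order (-1) 3) :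
    x + y ∈ order (-1) 3 ∨ x + y - ⟨1/2, 1/2, 1/2, -1/2⟩ ∈ order (-1) 3 := by
  rcases hx with hx | hx <;> rcases hy with hy | hy
  · exact Or.inl (Subring.add_mem _ hx hy)
  · right
    have : x + y - ⟨1/2, 1/2, 1/2, -1/2⟩ = x + (y - ⟨1/2, 1/2, 1/2, -1/2⟩) := by abel
    rw [this]; exact Subring.add_mem _ hx hy
  · right
    have : x + y - ⟨1/2, 1/2, 1/2, -1/2⟩ = (x - ⟨1/2, 1/2, 1/2, -1/2⟩) + y := by abel
    rw [this]; exact Subring.add_mem _ hx hy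
  · left
    have : x + y = (x - ⟨1/2, 1/2, 1/2, -1/2⟩) + (y - ⟨1/2, 1/2, 1/2, -1/2⟩) +
        (2 : ℚ) • (⟨1/2, 1/2, 1/2, -1/2⟩ : ℍ[ℚ,((-1 : ℤ) : ℚ),((3 : ℤ) : ℚ)]) := by
      rw [two_smul]; abel
    rw [this]; exact Subring.add_mem _ (Subring.add_mem _ hx hy) two_smul_e_mem_order

/-- `O₆` is closed under negation. [cite: BayerTravesa2007, §1] -/
theorem maxOrder_neg {x : ℍ[ℚ,((-1 : ℤ) : ℚ),((3 : ℤ) : ℚ)]}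
    (hx : x ∈ order (-1) 3 ∨ x - ⟨1/2, 1/2, 1/2, -1/2⟩ ∈ order (-1) 3) :
    -x ∈ order (-1) 3 ∨ -x - ⟨1/2, 1/2, 1/2, -1/2⟩ ∈ order (-1) 3 := by
  rcases hx with hx | hx
  · exact Or.inl (Subring.neg_mem _ hx)
  · right
    have : -x - ⟨1/2, 1/2, 1/2, -1/2⟩ = -(x - ⟨1/2, 1/2, 1/2, -1/2⟩) -
        (2 : ℚ) • (⟨1/2, 1/2, 1/2, -1/2⟩ : ℍ[ℚ,((-1 : ℤ) : ℚ),((3 : ℤ) : ℚ)]) := by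
      rw [two_smul]; abel
    rw [this]; exact Subring.sub_mem _ (Subring.neg_mem _ hx) two_smul_e_mem_order

/-- **`𝔬` has index `2` in `O₆`: `2·O₆ ⊆ 𝔬`** (and `e ∉ 𝔬`). [cite: BayerTravesa2007, §1] [cite: Lang1982AbelianFunctions, Ch. IX §4] -/
theorem two_smul_mem_order_of_maxOrder {x : ℍ[ℚ,((-1 : ℤ) : ℚ),((3 : ℤ) : ℚ)]}
    (hx : x ∈ order (-1) 3 ∨ x - ⟨1/2, 1/2, 1/2, -1/2⟩ ∈ order (-1) 3) : (2 : ℚ) • x ∈ order (-1) 3 := by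
  rcases hx with hx | hx
  · rw [two_smul]; exact Subring.add_mem _ hx hx
  · have : (2 : ℚ) • x = (2 : ℚ) • (x - ⟨1/2, 1/2, 1/2, -1/2⟩) +
        (2 : ℚ) • (⟨1/2, 1/2, 1/2, -1/2⟩ : ℍ[ℚ,((-1 : ℤ) : ℚ),((3 : ℤ) : ℚ)]) := by
      rw [← smul_add, sub_add_cancel]
    rw [this, two_smul ℚ (x - _)]
    exact Subring.add_mem _ (Subring.add_mem _ hx hx) two_smul_e_mem_order

/-- `n·e ∈ O₆` for `n ∈ 𝔬`: the numerators of `2·n·e` are all `≡ m₀ + m₁ + m₂ + m₃ (mod 2)`.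
[cite: BayerTravesa2007, §1 («`O₆ := ℤ[1, I, J, (1 + I + J + K)/2]`» is an order)] -/
theorem ofCoords_mul_e_mem_maxOrder (m : Fin 4 → ℤ) :
    ofCoords (-1) 3 (fun k ↦ ((m k : ℤ) : ℚ)) * (⟨1/2, 1/2, 1/2, -1/2⟩ : ℍ[ℚ,((-1 : ℤ) : ℚ),((3 : ℤ) : ℚ)]) ∈
        order (-1) 3 ∨
      ofCoords (-1) 3 (fun k ↦ ((m k : ℤ) : ℚ)) * (⟨1/2, 1/2, 1/2, -1/2⟩ : ℍ[ℚ,((-1 : ℤ) : ℚ),((3 : ℤ) : ℚ)]) -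
          ⟨1/2, 1/2, 1/2, -1/2⟩ ∈ order (-1) 3 := by
  have hn : ofCoords (-1) 3 (fun k ↦ ((m k : ℤ) : ℚ)) = ⟨m 0, m 1, m 2, m 3⟩ := by ext <;> simp [ofCoords]
  obtain ⟨q, hq | hq⟩ := Int.even_or_odd' (m 0 + m 1 + m 2 + m 3)
  · left
    have hq' : ((m 1 : ℤ) : ℚ) = 2 * q - m 0 - m 2 - m 3 := by
      have : m 1 = 2 * q - m 0 - m 2 - m 3 := by omega
      exact_mod_cast this
    refine ⟨![m 0 + 2 * m 2 - m 3 - q, m 2 + m 3 + q, q, -m 0 - m 2 + q], ?_⟩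
    rw [hn, QuaternionAlgebra.mk_mul_mk]
    ext <;> simp [ofCoords] <;> linarith
  · right
    have hq' : ((m 1 : ℤ) : ℚ) = 2 * q + 1 - m 0 - m 2 - m 3 := by
      have : m 1 = 2 * q + 1 - m 0 - m 2 - m 3 := by omega
      exact_mod_cast this
    refine ⟨![-1 + m 0 + 2 * m 2 - m 3 - q, m 2 + m 3 + q, q, 1 - m 0 - m 2 + q], ?_⟩
    rw [hn, QuaternionAlgebra.mk_mul_mk, QuaternionAlgebra.mk_sub_mk]
    ext <;> simp [ofCoords] <;> linarith

/-- `e·n ∈ O₆` for `n ∈ 𝔬`. [cite: BayerTravesa2007, §1] -/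
theorem e_mul_ofCoords_mem_maxOrder (m : Fin 4 → ℤ) :
    (⟨1/2, 1/2, 1/2, -1/2⟩ : ℍ[ℚ,((-1 : ℤ) : ℚ),((3 : ℤ) : ℚ)]) * ofCoords (-1) 3 (fun k ↦ ((m k : ℤ) : ℚ)) ∈
        order (-1) 3 ∨
      (⟨1/2, 1/2, 1/2, -1/2⟩ : ℍ[ℚ,((-1 : ℤ) : ℚ),((3 : ℤ) : ℚ)]) * ofCoords (-1) 3 (fun k ↦ ((m k : ℤ) : ℚ)) -
          ⟨1/2, 1/2, 1/2, -1/2⟩ ∈ order (-1) 3 := by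
  have hn : ofCoords (-1) 3 (fun k ↦ ((m k : ℤ) : ℚ)) = ⟨m 0, m 1, m 2, m 3⟩ := by ext <;> simp [ofCoords]
  obtain ⟨q, hq | hq⟩ := Int.even_or_odd' (m 0 + m 1 + m 2 + m 3)
  · left
    have hq' : ((m 1 : ℤ) : ℚ) = 2 * q - m 0 - m 2 - m 3 := by
      have : m 1 = 2 * q - m 0 - m 2 - m 3 := by omega
      exact_mod_cast this
    refine ⟨![m 0 + 2 * m 2 - m 3 - q, -2 * m 2 - 2 * m 3 + q, m 0 + m 2 - q, m 2 + m 3 - q], ?_⟩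
    rw [hn, QuaternionAlgebra.mk_mul_mk]
    ext <;> simp [ofCoords] <;> linarith
  · right
    have hq' : ((m 1 : ℤ) : ℚ) = 2 * q + 1 - m 0 - m 2 - m 3 := by
      have : m 1 = 2 * q + 1 - m 0 - m 2 - m 3 := by omega
      exact_mod_cast this
    refine ⟨![-1 + m 0 + 2 * m 2 - m 3 - q, -2 * m 2 - 2 * m 3 + q, -1 + m 0 + m 2 - q, m 2 + m 3 - q], ?_⟩
    rw [hn, QuaternionAlgebra.mk_mul_mk, QuaternionAlgebra.mk_sub_mk]
    ext <;> simp [ofCoords] <;> linarith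

/-- **`O₆ = 𝔬 ∪ (e + 𝔬)` IS CLOSED UNDER MULTIPLICATION** — it is the order `ℤ[1, I, J, (1 + I + J + K)/2]` of Bayer–Travesa
(their `I, J, K = IJ` are our `j, −i, ij`; `(1 + I + J + K)/2 − e = −i + ij ∈ 𝔬`), the MAXIMAL order of the quaternion algebra of
discriminant `6` («All maximal orders in `H₆` are conjugate, and we fix the representative … `O₆`»). [cite: BayerTravesa2007, §1] -/
theorem maxOrder_mul {x y : ℍ[ℚ,((-1 : ℤ) : ℚ),((3 : ℤ) : ℚ)]}
    (hx : x ∈ order (-1) 3 ∨ x - ⟨1/2, 1/2, 1/2, -1/2⟩ ∈ order (-1) 3)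
    (hy : y ∈ order (-1) 3 ∨ y - ⟨1/2, 1/2, 1/2, -1/2⟩ ∈ order (-1) 3) :
    x * y ∈ order (-1) 3 ∨ x * y - ⟨1/2, 1/2, 1/2, -1/2⟩ ∈ order (-1) 3 := by
  have hee : (⟨1/2, 1/2, 1/2, -1/2⟩ : ℍ[ℚ,((-1 : ℤ) : ℚ),((3 : ℤ) : ℚ)]) * ⟨1/2, 1/2, 1/2, -1/2⟩ ∈ order (-1) 3 ∨
      (⟨1/2, 1/2, 1/2, -1/2⟩ : ℍ[ℚ,((-1 : ℤ) : ℚ),((3 : ℤ) : ℚ)]) * ⟨1/2, 1/2, 1/2, -1/2⟩ - ⟨1/2, 1/2, 1/2, -1/2⟩ ∈ order (-1) 3 := by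
    right; rw [e_mul_e_eq_e_add_one, add_sub_cancel_left]; exact Subring.one_mem _
  rcases hx with hx | hx <;> rcases hy with hy | hy
  · exact Or.inl (Subring.mul_mem _ hx hy)
  · -- `x (n + e) = xn + xe`
    obtain ⟨m, rfl⟩ := hx
    have h1 : ofCoords (-1) 3 (fun k ↦ ((m k : ℤ) : ℚ)) * y =
        ofCoords (-1) 3 (fun k ↦ ((m k : ℤ) : ℚ)) * (y - ⟨1/2, 1/2, 1/2, -1/2⟩) +
          ofCoords (-1) 3 (fun k ↦ ((m k : ℤ) : ℚ)) * (⟨1/2, 1/2, 1/2, -1/2⟩ : ℍ[ℚ,((-1 : ℤ) : ℚ),((3 : ℤ) : ℚ)]) := by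
      rw [mul_sub, sub_add_cancel]
    rw [h1]
    exact maxOrder_add (Or.inl (Subring.mul_mem _ (ofCoords_intCast_mem_order _ _ _) hy))
      (ofCoords_mul_e_mem_maxOrder m)
  · obtain ⟨m, rfl⟩ := hy
    have h1 : x * ofCoords (-1) 3 (fun k ↦ ((m k : ℤ) : ℚ)) =
        (x - ⟨1/2, 1/2, 1/2, -1/2⟩) * ofCoords (-1) 3 (fun k ↦ ((m k : ℤ) : ℚ)) +
          (⟨1/2, 1/2, 1/2, -1/2⟩ : ℍ[ℚ,((-1 : ℤ) : ℚ),((3 : ℤ) : ℚ)]) * ofCoords (-1) 3 (fun k ↦ ((m k : ℤ) : ℚ)) := by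
      rw [sub_mul, sub_add_cancel]
    rw [h1]
    exact maxOrder_add (Or.inl (Subring.mul_mem _ hx (ofCoords_intCast_mem_order _ _ _)))
      (e_mul_ofCoords_mem_maxOrder m)
  · obtain ⟨m, hm⟩ := hx
    obtain ⟨m', hm'⟩ := hy
    have hx' : x = ofCoords (-1) 3 (fun k ↦ ((m k : ℤ) : ℚ)) + (⟨1/2, 1/2, 1/2, -1/2⟩ : ℍ[ℚ,((-1 : ℤ) : ℚ),((3 : ℤ) : ℚ)]) := by
      rw [hm, sub_add_cancel]
    have hy' : y = ofCoords (-1) 3 (fun k ↦ ((m' k : ℤ) : ℚ)) + (⟨1/2, 1/2, 1/2, -1/2⟩ : ℍ[ℚ,((-1 : ℤ) : ℚ),((3 : ℤ) : ℚ)]) := by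
      rw [hm', sub_add_cancel]
    have h1 : x * y = ofCoords (-1) 3 (fun k ↦ ((m k : ℤ) : ℚ)) * ofCoords (-1) 3 (fun k ↦ ((m' k : ℤ) : ℚ)) +
        ofCoords (-1) 3 (fun k ↦ ((m k : ℤ) : ℚ)) * (⟨1/2, 1/2, 1/2, -1/2⟩ : ℍ[ℚ,((-1 : ℤ) : ℚ),((3 : ℤ) : ℚ)]) +
        (⟨1/2, 1/2, 1/2, -1/2⟩ : ℍ[ℚ,((-1 : ℤ) : ℚ),((3 : ℤ) : ℚ)]) * ofCoords (-1) 3 (fun k ↦ ((m' k : ℤ) : ℚ)) +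
        (⟨1/2, 1/2, 1/2, -1/2⟩ : ℍ[ℚ,((-1 : ℤ) : ℚ),((3 : ℤ) : ℚ)]) * ⟨1/2, 1/2, 1/2, -1/2⟩ := by
      rw [hx', hy']; noncomm_ring
    rw [h1]
    exact maxOrder_add (maxOrder_add (maxOrder_add (Or.inl (Subring.mul_mem _ (ofCoords_intCast_mem_order _ _ _)
      (ofCoords_intCast_mem_order _ _ _))) (ofCoords_mul_e_mem_maxOrder m)) (e_mul_ofCoords_mem_maxOrder m')) hee

/-- **`Ad(e)`: `ex = (x₀, −2x₁ + 3x₂, −x₃, x₁ − 2x₂)·e`** (`i ↦ −2i + ij`, `j ↦ 3i − 2ij`, `ij ↦ −j`), an INTEGRAL automorphism of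
`𝔬`; `Ad(e)² = Ad(β)` of g30-#3. [cite: BayerTravesa2007, §1] [cite: Ogg1983RealPoints, §2 p. 283] -/
theorem e_mul_eq_ad_mul_e (x : ℍ[ℚ,((-1 : ℤ) : ℚ),((3 : ℤ) : ℚ)]) :
    (⟨1/2, 1/2, 1/2, -1/2⟩ : ℍ[ℚ,((-1 : ℤ) : ℚ),((3 : ℤ) : ℚ)]) * x =
      ⟨x.re, -2 * x.imI + 3 * x.imJ, -x.imK, x.imI - 2 * x.imJ⟩ * ⟨1/2, 1/2, 1/2, -1/2⟩ := by
  obtain ⟨x₀, x₁, x₂, x₃⟩ := x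
  rw [QuaternionAlgebra.mk_mul_mk, QuaternionAlgebra.mk_mul_mk]
  ext <;> simp <;> ring

/-- The inverse: `e·(y₀, −2y₁ − 3y₃, −y₁ − 2y₃, −y₂) = y·e` (`Ad(e)⁻¹`: `i ↦ −2i − j`, `j ↦ −ij`, `ij ↦ −3i − 2j`).
[cite: BayerTravesa2007, §1] [cite: Ogg1983RealPoints, §2 p. 283] -/
theorem e_mul_inv (y : ℍ[ℚ,((-1 : ℤ) : ℚ),((3 : ℤ) : ℚ)]) :
    (⟨1/2, 1/2, 1/2, -1/2⟩ : ℍ[ℚ,((-1 : ℤ) : ℚ),((3 : ℤ) : ℚ)]) * ⟨y.re, -2 * y.imI - 3 * y.imK, -y.imI - 2 * y.imK, -y.imJ⟩ =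
      y * ⟨1/2, 1/2, 1/2, -1/2⟩ := by
  obtain ⟨y₀, y₁, y₂, y₃⟩ := y
  rw [QuaternionAlgebra.mk_mul_mk, QuaternionAlgebra.mk_mul_mk]
  ext <;> simp <;> ring

/-- **`e𝔬 = 𝔬e`: `e` NORMALISES LANG'S ORDER** (so do `e² = β/2` — g30-#3 — and `e³ ∈ 𝔬^×`): `e𝔬 ⊆ 𝔬e` and `𝔬e ⊆ e𝔬`.
[cite: Ogg1983RealPoints, §2 p. 283 («`𝒪 = μ𝒪μ⁻¹`»)] [cite: BayerTravesa2007, §1] -/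
theorem exists_e_mul_eq_and {x : ℍ[ℚ,((-1 : ℤ) : ℚ),((3 : ℤ) : ℚ)]} (hx : x ∈ order (-1) 3) :
    (∃ y ∈ order (-1) 3, (⟨1/2, 1/2, 1/2, -1/2⟩ : ℍ[ℚ,((-1 : ℤ) : ℚ),((3 : ℤ) : ℚ)]) * x = y * ⟨1/2, 1/2, 1/2, -1/2⟩) ∧
    (∃ z ∈ order (-1) 3, x * (⟨1/2, 1/2, 1/2, -1/2⟩ : ℍ[ℚ,((-1 : ℤ) : ℚ),((3 : ℤ) : ℚ)]) = ⟨1/2, 1/2, 1/2, -1/2⟩ * z) := by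
  obtain ⟨m, rfl⟩ := hx
  refine ⟨⟨ofCoords (-1) 3 (fun k ↦ ((![m 0, -2 * m 1 + 3 * m 2, -m 3, m 1 - 2 * m 2] k : ℤ) : ℚ)),
      ofCoords_intCast_mem_order _ _ _, ?_⟩,
    ⟨ofCoords (-1) 3 (fun k ↦ ((![m 0, -2 * m 1 - 3 * m 3, -m 1 - 2 * m 3, -m 2] k : ℤ) : ℚ)),
      ofCoords_intCast_mem_order _ _ _, ?_⟩⟩
  · rw [e_mul_eq_ad_mul_e]; congr 1; ext <;> simp [ofCoords]
  · rw [← e_mul_inv]; congr 1; ext <;> simp [ofCoords]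

end MaximalOrder

/-! ## §3 `O₆¹ = 𝔬¹ ⊔ 𝔬¹e² ⊔ 𝔬¹e⁴`: the index of Lang's `Γ` in `Γ₆ = ρ(O₆¹)` is three -/

section Index

/-- **TRICHOTOMY, odd case: for `u = e + n`, `n ∈ 𝔬` with `n₀ + n₁ + n₂ + n₃` odd, `u·(e²)‾ ∈ 𝔬`** (explicit coordinates).
[cite: BayerTravesa2007, §1 (description of `Γ₆` from [AB04]: «`α ≡ β ≡ α√3 (mod 2)`»)] -/
theorem e_add_ofCoords_mul_star_e_sq (n : Fin 4 → ℤ) (q : ℤ) (hq : n 0 + n 1 + n 2 + n 3 = 2 * q + 1) :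
    ((⟨1/2, 1/2, 1/2, -1/2⟩ : ℍ[ℚ,((-1 : ℤ) : ℚ),((3 : ℤ) : ℚ)]) + ofCoords (-1) 3 (fun k ↦ ((n k : ℤ) : ℚ))) *
        star ((⟨1/2, 1/2, 1/2, -1/2⟩ : ℍ[ℚ,((-1 : ℤ) : ℚ),((3 : ℤ) : ℚ)]) * ⟨1/2, 1/2, 1/2, -1/2⟩) =
      ofCoords (-1) 3 (fun k ↦ ((![n 0 - 2 * n 2 + n 3 + q, 2 - 2 * n 0 - 3 * n 2 - 3 * n 3 + 3 * q, 2 * n 2 - q,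
        -1 + n 0 + n 2 + 2 * n 3 - q] k : ℤ) : ℚ)) := by
  have hq' : ((n 1 : ℤ) : ℚ) = 2 * q + 1 - n 0 - n 2 - n 3 := by
    have : n 1 = 2 * q + 1 - n 0 - n 2 - n 3 := by omega
    exact_mod_cast this
  have hn : ofCoords (-1) 3 (fun k ↦ ((n k : ℤ) : ℚ)) = ⟨n 0, n 1, n 2, n 3⟩ := by ext <;> simp [ofCoords]
  rw [hn, QuaternionAlgebra.mk_add_mk, star_e_sq, QuaternionAlgebra.mk_mul_mk]
  ext <;> simp [ofCoords] <;> linarith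

/-- **TRICHOTOMY, even case: for `u = e + n`, `n ∈ 𝔬` with `n₀ + n₁ + n₂ + n₃` even, `u·(e²)‾·(e²)‾ ∈ 𝔬`.** [cite: BayerTravesa2007, §1] -/
theorem e_add_ofCoords_mul_star_e_sq_mul_star_e_sq (n : Fin 4 → ℤ) (q : ℤ) (hq : n 0 + n 1 + n 2 + n 3 = 2 * q) :
    ((⟨1/2, 1/2, 1/2, -1/2⟩ : ℍ[ℚ,((-1 : ℤ) : ℚ),((3 : ℤ) : ℚ)]) + ofCoords (-1) 3 (fun k ↦ ((n k : ℤ) : ℚ))) *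
        star ((⟨1/2, 1/2, 1/2, -1/2⟩ : ℍ[ℚ,((-1 : ℤ) : ℚ),((3 : ℤ) : ℚ)]) * ⟨1/2, 1/2, 1/2, -1/2⟩) *
        star ((⟨1/2, 1/2, 1/2, -1/2⟩ : ℍ[ℚ,((-1 : ℤ) : ℚ),((3 : ℤ) : ℚ)]) * ⟨1/2, 1/2, 1/2, -1/2⟩) =
      ofCoords (-1) 3 (fun k ↦ ((![-2 + 2 * n 0 - 6 * n 2 + 3 * n 3 + 3 * q, 1 - 5 * n 0 - 8 * n 2 - 8 * n 3 + 7 * q,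
        1 + 5 * n 2 - 3 * q, -1 + 3 * n 0 + 3 * n 2 + 5 * n 3 - 3 * q] k : ℤ) : ℚ)) := by
  have hq' : ((n 1 : ℤ) : ℚ) = 2 * q - n 0 - n 2 - n 3 := by
    have : n 1 = 2 * q - n 0 - n 2 - n 3 := by omega
    exact_mod_cast this
  have hn : ofCoords (-1) 3 (fun k ↦ ((n k : ℤ) : ℚ)) = ⟨n 0, n 1, n 2, n 3⟩ := by ext <;> simp [ofCoords]
  rw [hn, QuaternionAlgebra.mk_add_mk, star_e_sq, QuaternionAlgebra.mk_mul_mk, QuaternionAlgebra.mk_mul_mk]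
  ext <;> simp [ofCoords] <;> linarith

/-- **`O₆ = 𝔬 ⊔ 𝔬·e² ⊔ 𝔬·e⁴` — every element of `O₆` is `v`, `v·e²` or `v·e²·e²` with `v ∈ 𝔬`** (`e²·(e²)‾ = 1`); in particular
**`O₆¹ = 𝔬¹ ⊔ 𝔬¹e² ⊔ 𝔬¹(e²)²`, i.e. `Γ₆ = Γ ⊔ Γσ ⊔ Γσ²`: Lang's curve `Γ∖𝔥` is a cyclic cover of degree three of the Shimura
curve `X₆ = Γ₆∖𝔥`** (disjointness: g30-#3's `rho_beta_ne_smul_rho_unit` and `rho_beta_sq_ne_smul_rho_unit` below).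
[cite: BayerTravesa2007, §1 («`Γ₆ = {γ = ½(α, β; −β′, α′) : α, β ∈ ℤ[√3], det γ = 1, α ≡ β ≡ α√3 (mod 2)}`», after [AB04])] [cite: Ogg1983RealPoints, §2 p. 283] -/
theorem exists_order_mul_e_pow {u : ℍ[ℚ,((-1 : ℤ) : ℚ),((3 : ℤ) : ℚ)]}
    (hu : u ∈ order (-1) 3 ∨ u - ⟨1/2, 1/2, 1/2, -1/2⟩ ∈ order (-1) 3) :
    ∃ v ∈ order (-1) 3, u = v ∨
      u = v * ((⟨1/2, 1/2, 1/2, -1/2⟩ : ℍ[ℚ,((-1 : ℤ) : ℚ),((3 : ℤ) : ℚ)]) * ⟨1/2, 1/2, 1/2, -1/2⟩) ∨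
      u = v * ((⟨1/2, 1/2, 1/2, -1/2⟩ : ℍ[ℚ,((-1 : ℤ) : ℚ),((3 : ℤ) : ℚ)]) * ⟨1/2, 1/2, 1/2, -1/2⟩) *
        ((⟨1/2, 1/2, 1/2, -1/2⟩ : ℍ[ℚ,((-1 : ℤ) : ℚ),((3 : ℤ) : ℚ)]) * ⟨1/2, 1/2, 1/2, -1/2⟩) := by
  rcases hu with hu | ⟨n, hn⟩
  · exact ⟨u, hu, Or.inl rfl⟩
  have hu' : u = ⟨1/2, 1/2, 1/2, -1/2⟩ + ofCoords (-1) 3 (fun k ↦ ((n k : ℤ) : ℚ)) := by rw [hn]; abel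
  obtain ⟨q, hq | hq⟩ := Int.even_or_odd' (n 0 + n 1 + n 2 + n 3)
  · -- even: `u (e²)‾ (e²)‾ ∈ 𝔬`, `u = (u (e²)‾ (e²)‾) e² e²`
    refine ⟨_, ⟨_, (e_add_ofCoords_mul_star_e_sq_mul_star_e_sq n q hq).symm⟩, Or.inr (Or.inr ?_)⟩
    rw [← hu', mul_assoc (u * star _), e_sq_mul_star_and.2, mul_one, mul_assoc u, e_sq_mul_star_and.2, mul_one]
  · -- odd: `u (e²)‾ ∈ 𝔬`, `u = (u (e²)‾) e²`
    refine ⟨_, ⟨_, (e_add_ofCoords_mul_star_e_sq n q hq).symm⟩, Or.inr (Or.inl ?_)⟩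
    rw [← hu', mul_assoc u, e_sq_mul_star_and.2, mul_one]

/-- Norms along the cosets: `nr(v·e²) = nr v` and `nr(v·e²·e²) = nr v`. [cite: BayerTravesa2007, §1] -/
theorem mul_e_sq_mul_star (v : ℍ[ℚ,((-1 : ℤ) : ℚ),((3 : ℤ) : ℚ)]) :
    v * ((⟨1/2, 1/2, 1/2, -1/2⟩ : ℍ[ℚ,((-1 : ℤ) : ℚ),((3 : ℤ) : ℚ)]) * ⟨1/2, 1/2, 1/2, -1/2⟩) *
        star (v * ((⟨1/2, 1/2, 1/2, -1/2⟩ : ℍ[ℚ,((-1 : ℤ) : ℚ),((3 : ℤ) : ℚ)]) * ⟨1/2, 1/2, 1/2, -1/2⟩)) =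
      v * star v := by
  rw [star_mul, mul_assoc, ← mul_assoc (_ * _) (star (_ * _)), e_sq_mul_star_and.1, one_mul]

/-- `det ρ(e²) = 1 > 0` and `ρ(e²)` acts on `𝔥` as `σ = ρ(β)` (`β = 2e²`). [cite: BayerTravesa2007, §1] [cite: Lang1982AbelianFunctions, Ch. IX §5 (3)] -/
theorem moebius_rho_e_sq (τ : ℂ) :
    moebius (rho (-1) 3 (by norm_num) (castQ (-1) 3
        ((⟨1/2, 1/2, 1/2, -1/2⟩ : ℍ[ℚ,((-1 : ℤ) : ℚ),((3 : ℤ) : ℚ)]) * ⟨1/2, 1/2, 1/2, -1/2⟩))) τ =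
      moebius (rho (-1) 3 (by norm_num) (castQ (-1) 3 (⟨3, 1, 1, -1⟩ : ℍ[ℚ,((-1 : ℤ) : ℚ),((3 : ℤ) : ℚ)]))) τ := by
  rw [beta_eq_two_smul_e_sq, castQ_smul, map_smul, moebius_smul_of_ne_zero (by norm_num)]

/-- `det ρ(e²) = 1`. [cite: BayerTravesa2007, §1] -/
theorem det_rho_e_sq :
    (rho (-1) 3 (by norm_num) (castQ (-1) 3
        ((⟨1/2, 1/2, 1/2, -1/2⟩ : ℍ[ℚ,((-1 : ℤ) : ℚ),((3 : ℤ) : ℚ)]) * ⟨1/2, 1/2, 1/2, -1/2⟩))).det = 1 := by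
  rw [det_rho_castQ, e_sq_eq, QuaternionAlgebra.star_mk, QuaternionAlgebra.mk_mul_mk]
  norm_num

/-- **`Γ₆ = Γ ∪ Γσ ∪ Γσ²` ON `𝔥`**: for every `u ∈ O₆` of reduced norm `1` there is `v ∈ 𝔬¹ = 𝔬 ∩ {nr = 1}` with
`ρ(u) = ρ(v)`, `ρ(u) = ρ(v)∘σ` or `ρ(u) = ρ(v)∘σ∘σ` as maps of `𝔥`. [cite: BayerTravesa2007, §1 («`(O₆)*₁` … can be identified with its image `Γ₆ ⊆ SL(2, ℝ)`»)] [cite: Ogg1983RealPoints, §2 p. 283] [cite: Lang1982AbelianFunctions, Ch. IX §5 Thm. 5.1] -/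
theorem exists_order_unit_moebius_eq {u : ℍ[ℚ,((-1 : ℤ) : ℚ),((3 : ℤ) : ℚ)]}
    (hu : u ∈ order (-1) 3 ∨ u - ⟨1/2, 1/2, 1/2, -1/2⟩ ∈ order (-1) 3) (hu1 : u * star u = 1) :
    ∃ v ∈ order (-1) 3, v * star v = 1 ∧
      ((∀ τ : UpperHalfPlane, moebius (rho (-1) 3 (by norm_num) (castQ (-1) 3 u)) (τ : ℂ) =
          moebius (rho (-1) 3 (by norm_num) (castQ (-1) 3 v)) (τ : ℂ)) ∨
        (∀ τ : UpperHalfPlane, moebius (rho (-1) 3 (by norm_num) (castQ (-1) 3 u)) (τ : ℂ) =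
          moebius (rho (-1) 3 (by norm_num) (castQ (-1) 3 v))
            (moebius (rho (-1) 3 (by norm_num) (castQ (-1) 3 (⟨3, 1, 1, -1⟩ : ℍ[ℚ,((-1 : ℤ) : ℚ),((3 : ℤ) : ℚ)])))
              (τ : ℂ))) ∨
        (∀ τ : UpperHalfPlane, moebius (rho (-1) 3 (by norm_num) (castQ (-1) 3 u)) (τ : ℂ) =
          moebius (rho (-1) 3 (by norm_num) (castQ (-1) 3 v))
            (moebius (rho (-1) 3 (by norm_num) (castQ (-1) 3 (⟨3, 1, 1, -1⟩ : ℍ[ℚ,((-1 : ℤ) : ℚ),((3 : ℤ) : ℚ)])))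
              (moebius (rho (-1) 3 (by norm_num) (castQ (-1) 3 (⟨3, 1, 1, -1⟩ : ℍ[ℚ,((-1 : ℤ) : ℚ),((3 : ℤ) : ℚ)])))
                (τ : ℂ))))) := by
  obtain ⟨v, hv, h⟩ := exists_order_mul_e_pow hu
  have hdetE : 0 < (rho (-1) 3 (by norm_num) (castQ (-1) 3 ((⟨1/2, 1/2, 1/2, -1/2⟩ : ℍ[ℚ,((-1 : ℤ) : ℚ),((3 : ℤ) : ℚ)]) * ⟨1/2, 1/2, 1/2, -1/2⟩))).det := by
    rw [det_rho_e_sq]; exact one_pos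
  -- the norm of `v`
  have hv1 : v * star v = 1 := by
    rcases h with rfl | rfl | rfl
    · exact hu1
    · rwa [mul_e_sq_mul_star] at hu1
    · rwa [mul_e_sq_mul_star, mul_e_sq_mul_star] at hu1
  have hdetv : 0 < (rho (-1) 3 (by norm_num) (castQ (-1) 3 v)).det := by
    rw [det_rho_castQ, hv1, QuaternionAlgebra.re_one]; exact_mod_cast one_pos
  have hdetvE : 0 < (rho (-1) 3 (by norm_num) (castQ (-1) 3 (v * ((⟨1/2, 1/2, 1/2, -1/2⟩ : ℍ[ℚ,((-1 : ℤ) : ℚ),((3 : ℤ) : ℚ)]) * ⟨1/2, 1/2, 1/2, -1/2⟩)))).det := by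
    rw [castQ_mul, map_mul, Matrix.det_mul]; exact mul_pos hdetv hdetE
  refine ⟨v, hv, hv1, ?_⟩
  rcases h with rfl | rfl | rfl
  · exact Or.inl fun τ ↦ rfl
  · refine Or.inr (Or.inl fun τ ↦ ?_)
    rw [castQ_mul, map_mul, moebius_mul_of_det_pos hdetv hdetE τ, moebius_rho_e_sq]
  · refine Or.inr (Or.inr fun τ ↦ ?_)
    have h2 := moebius_mul_of_det_pos hdetv hdetE ⟨_, im_sigma_coe_pos τ⟩
    simp only at h2
    rw [castQ_mul, map_mul, moebius_mul_of_det_pos hdetvE hdetE τ, moebius_rho_e_sq, castQ_mul, map_mul, h2,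
      moebius_rho_e_sq]

/-- **`ρ(β²) ∉ ℝ^×ρ(𝔬^×)`**: with g30-#3's `ρ(β) ∉ ℝ^×ρ(𝔬^×)` the three cosets `Γ`, `Γσ`, `Γσ²` are pairwise distinct —
**`[Γ₆ : Γ] = 3`** (`β² = 2(7 + 3i + 3j − 3ij)`; `7 + 3i + 3j − 3ij = cε` forces `ε = ε₁(7, 3, 3, −3)/3`, `3 ∣ ε₁`… precisely:
`7ε₁ = 3ε₀`, so `ε = t(7, 3, 3, −3)` with `t ∈ ℤ` and `nr ε = 4t² ≠ ±1`). [cite: BayerTravesa2007, §1] [cite: Ogg1983RealPoints, §2 p. 283] -/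
theorem rho_beta_sq_ne_smul_rho_unit (c : ℝ) {ε : ℍ[ℚ,((-1 : ℤ) : ℚ),((3 : ℤ) : ℚ)]} (hε : ε ∈ order (-1) 3)
    (hunit : ε * star ε = 1 ∨ ε * star ε = -1) :
    rho (-1) 3 (by norm_num) (castQ (-1) 3 (⟨7, 3, 3, -3⟩ : ℍ[ℚ,((-1 : ℤ) : ℚ),((3 : ℤ) : ℚ)])) ≠
      c • rho (-1) 3 (by norm_num) (castQ (-1) 3 ε) := by
  intro h
  rw [← map_smul] at h
  have h' := rho_injective (a := -1) (b := 3) (by norm_num) (by norm_num) h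
  obtain ⟨m, rfl⟩ := hε
  have h0 := congrArg QuaternionAlgebra.re h'
  have h1 := congrArg QuaternionAlgebra.imI h'
  have h2 := congrArg QuaternionAlgebra.imJ h'
  have h3 := congrArg QuaternionAlgebra.imK h'
  simp [castQ, ofCoords] at h0 h1 h2 h3
  have hc : c ≠ 0 := by rintro rfl; norm_num at h1
  -- `7 m₁ = 3 m₀`, `m₂ = m₁`, `m₃ = −m₁`
  have hm0 : (7 : ℝ) * m 1 = 3 * m 0 := by
    have : c * (7 * m 1 - 3 * m 0) = 0 := by linear_combination -7 * h1 + 3 * h0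
    have := (mul_eq_zero.1 this).resolve_left hc
    linarith
  have hm2 : (m 2 : ℝ) = m 1 := by
    have : c * (m 2 - m 1) = 0 := by linear_combination -h2 + h1
    have := (mul_eq_zero.1 this).resolve_left hc
    linarith
  have hm3 : (m 3 : ℝ) = -m 1 := by
    have : c * (m 3 + m 1) = 0 := by linear_combination -h3 - h1
    have := (mul_eq_zero.1 this).resolve_left hc
    linarith
  have hm0' : 7 * m 1 = 3 * m 0 := by exact_mod_cast hm0
  have hm2' : m 2 = m 1 := by exact_mod_cast hm2
  have hm3' : m 3 = -m 1 := by exact_mod_cast hm3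
  -- `3 ∣ m₁`: `m₁ = 3t`, `m₀ = 7t`
  obtain ⟨t, ht⟩ : ∃ t, m 1 = 3 * t := ⟨m 1 / 3, by omega⟩
  have hm0t : m 0 = 7 * t := by omega
  have hn : (ofCoords (-1) 3 (fun k ↦ ((m k : ℤ) : ℚ)) * star (ofCoords (-1) 3 (fun k ↦ ((m k : ℤ) : ℚ)))).re =
      4 * (t : ℚ) ^ 2 := by
    simp only [QuaternionAlgebra.re_mul, QuaternionAlgebra.re_star, QuaternionAlgebra.imI_star, QuaternionAlgebra.imJ_star,
      QuaternionAlgebra.imK_star, ofCoords_re, ofCoords_imI, ofCoords_imJ, ofCoords_imK, hm0t, hm2', hm3', ht]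
    push_cast
    ring
  rcases hunit with hu | hu
  · have := congrArg QuaternionAlgebra.re hu
    rw [hn, QuaternionAlgebra.re_one] at this
    have h4 : (4 : ℚ) * (t : ℚ) ^ 2 = 1 := this
    have : (2 * t) * (2 * t) = (1 : ℤ) := by exact_mod_cast (by linear_combination h4 : (2 * (t : ℚ)) * (2 * t) = 1)
    rcases Int.eq_one_or_neg_one_of_mul_eq_one this with h | h <;> omega
  · have := congrArg QuaternionAlgebra.re hu
    rw [hn, QuaternionAlgebra.re_neg, QuaternionAlgebra.re_one] at this
    have h4 : (4 : ℚ) * (t : ℚ) ^ 2 = -1 := this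
    nlinarith [sq_nonneg (t : ℚ)]

end Index

/-! ## §4 The elliptic points and the special CM points of `X₆` (Bayer–Travesa Thm. 1.1, Table 1) seen from Lang's curve -/

section XSix

variable {a b : ℤ}

/-- **A norm-one conjugating element moves the fixed point**: `exē = y` (`y` special, `eē = 1`), `ρ(x)z₁ = z₁`, `ρ(y)z₂ = z₂`
(`z₁, z₂ ∈ 𝔥`) ⟹ `ρ(e)z₁ = z₂` (the equality behind g30-#3's `isRhoIsomorphic_of_conj_norm_one`, here for ANY `e` of norm one,
in `𝔬` or not). [cite: KudlaRapoportYang2006, §3.4 (3.4.9) and §3.2 (3.2.4)] [cite: Lang1982AbelianFunctions, Ch. IX §5 (3)] -/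
theorem moebius_eq_of_conj_norm_one (hb : 0 < b) {x y e : ℍ[ℚ,(a : ℚ),(b : ℚ)]} (hy : y.re = 0)
    (hty : 0 < (y * star y).re) (hn : e * star e = 1) (hconj : e * x * star e = y) {z₁ z₂ : ℂ}
    (hz₁ : 0 < z₁.im) (hz₂ : 0 < z₂.im) (hfix₁ : moebius (rho a b hb.le (castQ a b x)) z₁ = z₁)
    (hfix₂ : moebius (rho a b hb.le (castQ a b y)) z₂ = z₂) : moebius (rho a b hb.le (castQ a b e)) z₁ = z₂ := by
  have hepos : (0 : ℚ) < (e * star e).re := by rw [hn]; simp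
  have hfix' : moebius (rho a b hb.le (castQ a b y)) (moebius (rho a b hb.le (castQ a b e)) z₁) =
      moebius (rho a b hb.le (castQ a b e)) z₁ := by
    have h := moebius_conj_fixed hb hepos ⟨z₁, hz₁⟩ (det_rho_pos_of_fixed hb ⟨z₁, hz₁⟩ hfix₁) hfix₁
    rwa [hconj] at h
  have hdet : 0 < (rho a b hb.le (castQ a b e)).det := by rw [det_rho_castQ]; exact_mod_cast hepos
  have hpos : 0 < (moebius (rho a b hb.le (castQ a b e)) z₁).im := im_moebius_pos_of_det_pos hdet ⟨z₁, hz₁⟩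
  have key := (existsUnique_fixedPoint_of_special hb.le hy hty).unique (y₁ := ⟨_, hpos⟩) (y₂ := ⟨z₂, hz₂⟩) hfix' hfix₂
  rwa [UpperHalfPlane.ext_iff] at key

/-- **`P₃ ≡ P₅ (mod Γ₆)`: `τ_h = (√3 + i)/2` and `τ_k = (2 − √3)i` — two of the three `Γ`-inequivalent elliptic points of
Lang's curve with `A ≅ C_i²` (g29-#3) — are `Γ₆`-EQUIVALENT**: `u = −i·e² = (1 − 3i − j − ij)/2 ∈ O₆`, `nr u = 1`,
`ρ(u)τ_h = τ_k`. [cite: BayerTravesa2007, §1 Thm. 1.1 («`P₁ ≡ P₃ ≡ P₅ (mod Γ₆)`») and Table 1 (`P₃ = (2 − √3)i`, `P₅ = (√3 + i)/2`)] -/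
theorem exists_maxOrder_unit_moebius_tauHex_eq_tauK :
    ∃ u : ℍ[ℚ,((-1 : ℤ) : ℚ),((3 : ℤ) : ℚ)], u - ⟨1/2, 1/2, 1/2, -1/2⟩ ∈ order (-1) 3 ∧ u * star u = 1 ∧
      moebius (rho (-1) 3 (by norm_num) (castQ (-1) 3 u)) (⟨Real.sqrt 3 / 2, 1 / 2⟩ : ℂ) = ⟨0, 2 - Real.sqrt 3⟩ := by
  refine ⟨⟨1/2, -3/2, -1/2, -1/2⟩, ⟨![0, -2, -1, 0], by rw [QuaternionAlgebra.mk_sub_mk]; ext <;> simp [ofCoords] <;> norm_num⟩,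
    by rw [QuaternionAlgebra.star_mk, QuaternionAlgebra.mk_mul_mk]; ext <;> norm_num, ?_⟩
  -- `u = (−i)·e²`, `ρ(u)τ_h = ρ(−i)(στ_h) = τ_k`
  have hu : (⟨1/2, -3/2, -1/2, -1/2⟩ : ℍ[ℚ,((-1 : ℤ) : ℚ),((3 : ℤ) : ℚ)]) =
      ⟨0, -1, 0, 0⟩ * ((⟨1/2, 1/2, 1/2, -1/2⟩ : ℍ[ℚ,((-1 : ℤ) : ℚ),((3 : ℤ) : ℚ)]) * ⟨1/2, 1/2, 1/2, -1/2⟩) := by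
    rw [e_sq_eq, QuaternionAlgebra.mk_mul_mk]; ext <;> norm_num
  have hdeti : 0 < (rho (-1) 3 (by norm_num) (castQ (-1) 3 (⟨0, -1, 0, 0⟩ : ℍ[ℚ,((-1 : ℤ) : ℚ),((3 : ℤ) : ℚ)]))).det := by
    rw [det_rho_castQ, QuaternionAlgebra.star_mk, QuaternionAlgebra.mk_mul_mk]; norm_num
  have hdetE : 0 < (rho (-1) 3 (by norm_num) (castQ (-1) 3
      ((⟨1/2, 1/2, 1/2, -1/2⟩ : ℍ[ℚ,((-1 : ℤ) : ℚ),((3 : ℤ) : ℚ)]) * ⟨1/2, 1/2, 1/2, -1/2⟩))).det := by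
    rw [det_rho_e_sq]; exact one_pos
  rw [hu, castQ_mul, map_mul, moebius_mul_of_det_pos hdeti hdetE ⟨⟨Real.sqrt 3 / 2, 1 / 2⟩, tauHex_im_pos⟩]
  simp only
  rw [moebius_rho_e_sq]
  exact moebius_eq_of_conj_norm_one (a := -1) (b := 3) (by norm_num) (x := ⟨0, 2, 0, -1⟩) (y := ⟨0, 2, 0, 1⟩) rfl
    (by rw [QuaternionAlgebra.star_mk, QuaternionAlgebra.mk_mul_mk]; norm_num) witnessUnits_norm_one.2.1 witness_conj.2.1
    (im_sigma_coe_pos ⟨_, tauHex_im_pos⟩) tauK_im_pos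
    (moebius_rho_fixed_of_beta_conj beta_conj_vectors.2.1 ⟨_, tauHex_im_pos⟩ moebius_rho_two_i_add_j_tauHex) moebius_rho_tauK

/-- **`P₇ ≡ στ₆`: `τ₆ = (√3 + i√6)/3` (Bayer–Travesa's SCM point `P₇ = (1 + √2 i)/√3`) and `τ₆″` are `Γ₆`-EQUIVALENT**
(`u = −i·e²`, `ρ(u)τ₆ = τ₆″`), although `Γ`-inequivalent (g29-#3). [cite: BayerTravesa2007, §1 Thm. 1.1 and Table 1 (`P₇`)] [cite: KudlaRapoportYang2006, §3.4 (3.4.13)] -/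
theorem exists_maxOrder_unit_moebius_tauSix_eq_tauSixBis :
    ∃ u : ℍ[ℚ,((-1 : ℤ) : ℚ),((3 : ℤ) : ℚ)], u - ⟨1/2, 1/2, 1/2, -1/2⟩ ∈ order (-1) 3 ∧ u * star u = 1 ∧
      moebius (rho (-1) 3 (by norm_num) (castQ (-1) 3 u)) (⟨Real.sqrt 3 / 3, Real.sqrt 6 / 3⟩ : ℂ) =
        ⟨Real.sqrt 3 / (6 + 3 * Real.sqrt 3), Real.sqrt 6 / (6 + 3 * Real.sqrt 3)⟩ := by
  refine ⟨⟨1/2, -3/2, -1/2, -1/2⟩, ⟨![0, -2, -1, 0], by rw [QuaternionAlgebra.mk_sub_mk]; ext <;> simp [ofCoords] <;> norm_num⟩,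
    by rw [QuaternionAlgebra.star_mk, QuaternionAlgebra.mk_mul_mk]; ext <;> norm_num, ?_⟩
  have hu : (⟨1/2, -3/2, -1/2, -1/2⟩ : ℍ[ℚ,((-1 : ℤ) : ℚ),((3 : ℤ) : ℚ)]) =
      ⟨0, -1, 0, 0⟩ * ((⟨1/2, 1/2, 1/2, -1/2⟩ : ℍ[ℚ,((-1 : ℤ) : ℚ),((3 : ℤ) : ℚ)]) * ⟨1/2, 1/2, 1/2, -1/2⟩) := by
    rw [e_sq_eq, QuaternionAlgebra.mk_mul_mk]; ext <;> norm_num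
  have hdeti : 0 < (rho (-1) 3 (by norm_num) (castQ (-1) 3 (⟨0, -1, 0, 0⟩ : ℍ[ℚ,((-1 : ℤ) : ℚ),((3 : ℤ) : ℚ)]))).det := by
    rw [det_rho_castQ, QuaternionAlgebra.star_mk, QuaternionAlgebra.mk_mul_mk]; norm_num
  have hdetE : 0 < (rho (-1) 3 (by norm_num) (castQ (-1) 3
      ((⟨1/2, 1/2, 1/2, -1/2⟩ : ℍ[ℚ,((-1 : ℤ) : ℚ),((3 : ℤ) : ℚ)]) * ⟨1/2, 1/2, 1/2, -1/2⟩))).det := by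
    rw [det_rho_e_sq]; exact one_pos
  rw [hu, castQ_mul, map_mul, moebius_mul_of_det_pos hdeti hdetE ⟨⟨Real.sqrt 3 / 3, Real.sqrt 6 / 3⟩, tauSix_im_pos⟩]
  simp only
  rw [moebius_rho_e_sq]
  exact moebius_eq_of_conj_norm_one (a := -1) (b := 3) (by norm_num) (x := ⟨0, 6, -1, -3⟩) (y := ⟨0, 6, 1, 3⟩) rfl
    (by rw [QuaternionAlgebra.star_mk, QuaternionAlgebra.mk_mul_mk]; norm_num) witnessUnits_norm_one.2.1
    witness_conj.2.2.2.2.2.2.1 (im_sigma_coe_pos ⟨_, tauSix_im_pos⟩) tauSixBis_im_pos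
    (moebius_rho_fixed_of_beta_conj beta_conj_vectors.2.2.2.2.2.2.1 ⟨_, tauSix_im_pos⟩ moebius_rho_tauSix)
    moebius_rho_tauSixBis

/-- **`P₆ ≢ P₅ (mod Γ₆)`: the elliptic points `i` and `τ_h` stay inequivalent under the MAXIMAL order's group `Γ₆`** — they are
the two elliptic points of order `2` of `X₆` («`P₁ ≡ P₃ ≡ P₅ (mod Γ₆)` and `P₆` are elliptic of order `2`»). Proof from Lang's
curve: `Γ₆ = Γ ⊔ Γσ ⊔ Γσ²` (§3) and `i`, `σi ≅_ρ w₃τ_h`, `σ²i ≅_ρ w₃τ_k` are all `Γ`-inequivalent to `τ_h` (g29-#7, g30-#3).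
[cite: BayerTravesa2007, §1 Thm. 1.1 and Table 1 (`P₅ = (√3 + i)/2`, `P₆ = i`)] [cite: KudlaRapoportYang2006, §3.2 Prop. 3.2.1] -/
theorem not_exists_maxOrder_unit_moebius_I_eq_tauHex :
    ¬ ∃ u : ℍ[ℚ,((-1 : ℤ) : ℚ),((3 : ℤ) : ℚ)], (u ∈ order (-1) 3 ∨ u - ⟨1/2, 1/2, 1/2, -1/2⟩ ∈ order (-1) 3) ∧
      u * star u = 1 ∧ moebius (rho (-1) 3 (by norm_num) (castQ (-1) 3 u)) I = (⟨Real.sqrt 3 / 2, 1 / 2⟩ : ℂ) := by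
  rintro ⟨u, hu, hu1, hmob⟩
  obtain ⟨v, hv, hv1, h⟩ := exists_order_unit_moebius_eq hu hu1
  have hI : (0 : ℝ) < (I : ℂ).im := by simp
  rcases h with h | h | h
  · -- `u ∈ Γ`: `i ≅_ρ τ_h`
    have h' := h ⟨I, hI⟩
    simp only at h'
    rw [h'] at hmob
    exact zOne_six_points.1 ((isRhoIsomorphic_iff_exists_unit_pm (a := -1) (b := 3) (by norm_num) (by norm_num)
      _ _).2 ⟨v, hv, Or.inl hv1, hmob⟩)
  · -- `u ∈ Γσ`: `σi ≅_ρ τ_h`, but `σi ≅_ρ w₃τ_h ≇_ρ τ_h`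
    have h' := h ⟨I, hI⟩
    simp only at h'
    rw [h'] at hmob
    have hiso : IsRhoIsomorphic (a := -1) (b := 3) (by norm_num) (by norm_num) (im_sigma_coe_pos ⟨I, hI⟩).ne'
        tauHex_im_ne_zero :=
      (isRhoIsomorphic_iff_exists_unit_pm (a := -1) (b := 3) (by norm_num) (by norm_num) _ _).2
        ⟨v, hv, Or.inl hv1, hmob⟩
    exact zOne_six_points.2.2.2.2.2.2.2.1 (hiso.symm.trans isRhoIsomorphic_sigma_I_w3tauHex)
  · -- `u ∈ Γσ²`: `σ²i ≅_ρ τ_h`, but `σ²i ≅_ρ w₃τ_k ≇_ρ τ_h`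
    have h' := h ⟨I, hI⟩
    simp only at h'
    rw [h'] at hmob
    have hiso : IsRhoIsomorphic (a := -1) (b := 3) (by norm_num) (by norm_num)
        (im_sigma_coe_pos ⟨_, im_sigma_coe_pos ⟨I, hI⟩⟩).ne' tauHex_im_ne_zero :=
      (isRhoIsomorphic_iff_exists_unit_pm (a := -1) (b := 3) (by norm_num) (by norm_num) _ _).2
        ⟨v, hv, Or.inl hv1, hmob⟩
    exact zOne_six_points.2.2.2.2.2.2.2.2.1 (hiso.symm.trans zOne_one_orbit.2.1)

/-- **`P₀ ≢ P₇ (mod Γ₆)`: the `Z(6)`-points `i√(2 − √3)` (Bayer–Travesa's `P₀ = (√6 − √2)i/2`) and `τ₆` (`P₇`) are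
`Γ₆`-INEQUIVALENT** — «`P₀, P₇ ≡ P₈ (mod Γ₆)` are a full set of representatives of the special complex multiplication points of
`X₆`»; from Lang's curve: `τ₆`, `στ₆ ≅_ρ τ₆″`, `σ²τ₆ ≅_ρ w₃ i√(2−√3)` are `Γ`-inequivalent to `i√(2 − √3)` (g29-#3/#7, g30-#3).
[cite: BayerTravesa2007, §1 Thm. 1.1 and Table 1 (`P₀`, `P₇`)] [cite: KudlaRapoportYang2006, §3.4 (3.4.13)] -/
theorem not_exists_maxOrder_unit_moebius_tauSix_eq_axis :
    ¬ ∃ u : ℍ[ℚ,((-1 : ℤ) : ℚ),((3 : ℤ) : ℚ)], (u ∈ order (-1) 3 ∨ u - ⟨1/2, 1/2, 1/2, -1/2⟩ ∈ order (-1) 3) ∧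
      u * star u = 1 ∧ moebius (rho (-1) 3 (by norm_num) (castQ (-1) 3 u)) (⟨Real.sqrt 3 / 3, Real.sqrt 6 / 3⟩ : ℂ) =
        ((Real.sqrt (2 - Real.sqrt 3) : ℝ) : ℂ) * I := by
  rintro ⟨u, hu, hu1, hmob⟩
  obtain ⟨v, hv, hv1, h⟩ := exists_order_unit_moebius_eq hu hu1
  rcases h with h | h | h
  · have h' := h ⟨_, tauSix_im_pos⟩
    simp only at h'
    rw [h'] at hmob
    exact zSix_six_points.1 ((isRhoIsomorphic_iff_exists_unit_pm (a := -1) (b := 3) (by norm_num) (by norm_num)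
      _ _).2 ⟨v, hv, Or.inl hv1, hmob⟩)
  · have h' := h ⟨_, tauSix_im_pos⟩
    simp only at h'
    rw [h'] at hmob
    have hiso : IsRhoIsomorphic (a := -1) (b := 3) (by norm_num) (by norm_num)
        (im_sigma_coe_pos ⟨_, tauSix_im_pos⟩).ne' (ofReal_mul_I_im_ne_zero sqrt_two_sub_sqrt_three_pos.ne') :=
      (isRhoIsomorphic_iff_exists_unit_pm (a := -1) (b := 3) (by norm_num) (by norm_num) _ _).2
        ⟨v, hv, Or.inl hv1, hmob⟩
    exact zSix_six_points.2.2.2.2.2.1 (hiso.symm.trans isRhoIsomorphic_sigma_tauSix_tauSixBis)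
  · have h' := h ⟨_, tauSix_im_pos⟩
    simp only at h'
    rw [h'] at hmob
    have hiso : IsRhoIsomorphic (a := -1) (b := 3) (by norm_num) (by norm_num)
        (im_sigma_coe_pos ⟨_, im_sigma_coe_pos ⟨_, tauSix_im_pos⟩⟩).ne'
        (ofReal_mul_I_im_ne_zero sqrt_two_sub_sqrt_three_pos.ne') :=
      (isRhoIsomorphic_iff_exists_unit_pm (a := -1) (b := 3) (by norm_num) (by norm_num) _ _).2
        ⟨v, hv, Or.inl hv1, hmob⟩
    exact zSix_six_points.2.2.2.2.2.2.2.1 (hiso.symm.trans zSix_one_orbit.2.1)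

end XSix

end Literature.Geometry.Kaehler.ComplexTorus.QuaternionType
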